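import Mathlib
import Literature.NumberTheory.Automorphic.RankinSelbergLocal
import Literature.NumberTheory.Automorphic.LocalFieldHaarBalls
import Summits.Langlands.Langlands.Theorems.IrreducibilityBySelfDualityPairLBoundaryJSMellinEntire
import HarnessLib

/-!
# Local Rankin–Selberg zeta integrals with compactly supported kernels are entire

Route `IrreducibilityBySelfDuality`, crux `PairLBoundaryJS` (stmt-Langlands-13622), line `Sketch`
(card `compact-kirillov-local-division`), stub `rsZeta_differentiable_of_hasCompactSupport`.

For `m < n` over a non-archimedean local field `F`, the tree's local Rankin–Selberg zeta integral
`rsZeta hmn ν W W' s = ∫_{GL_m(F) ⧸ U_m} rsKernel hmn W W' s dν` (Jacquet–Piatetski-Shapiro–Shalika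
1983, §2.4; `Literature/NumberTheory/Automorphic/RankinSelbergLocal`) is an ENTIRE function of `s`
as soon as its kernel is, for every `s`, continuous and compactly supported on `GL_m(F) ⧸ U_m` — the
situation of a Whittaker function `W` whose restriction to the mirabolic is compactly supported
modulo `N_n` (Gelfand–Kazhdan / Bernstein–Zelevinsky). The point is the shape of the integrand:
`rsIntegrand hmn W W' s g = B(g) · |det g⁻¹|_F ^ (s - (n - m)/2)` with `B(g) = W(diag(g⁻¹, 1)) W'(g⁻¹)`
independent of `s` and `|det g⁻¹|_F > 0` continuous and `U_m`-invariant, so that `rsZeta` is a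
Mellin-type integral `∫ k₀(x) a(x)^{s - c} dν(x)` of the compactly supported continuous kernel
`k₀ = rsKernel hmn W W' c` against the continuous positive weight `a = |det|⁻¹`, entire by
`mellin_entire_of_hasCompactSupport`. (The right-`U_m`-invariance of the integrand, which `rsKernel`
tests, does not depend on `s`; when it fails the kernel is the documented junk value `0` and
`rsZeta = 0`.)
-/

noncomputable section

-- `Summit.Langlands.Langlands.…` (summit = sub-problem name, D-0017 layout) trips `dupNamespace`
set_option linter.dupNamespace false

open scoped MatrixGroups Topology NNReal
open MeasureTheory Filter
open Literature.NumberTheory.Automorphic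
open Literature.NumberTheory.GaloisRepresentations.IsNonarchimedeanLocalField

namespace Summit.Langlands.Langlands.Theorems

section Weight

variable {F : Type*} [Field F] [ValuativeRel F] [TopologicalSpace F] [IsNonarchimedeanLocalField F]
  {n m : ℕ}

/-- The modulus weight `|det g⁻¹|_F` of the JPSS integrand is positive: `det g⁻¹ ≠ 0` and `|·|_F`
vanishes only at `0`. -/
theorem rsDetWeight_pos (g : GL (Fin m) F) :
    0 < ((normAbs F ((Matrix.GeneralLinearGroup.det g⁻¹ : Fˣ) : F) : ℝ≥0) : ℝ) := by
  have h : normAbs F ((Matrix.GeneralLinearGroup.det g⁻¹ : Fˣ) : F) ≠ 0 :=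
    (map_ne_zero (normAbs F)).2 (Units.ne_zero _)
  exact_mod_cast pos_iff_ne_zero.2 h

/-- The modulus weight is right-`U_m`-invariant (`det u = 1` on the unitriangular subgroup). -/
theorem rsDetWeight_mul_upperUnitriangular (g : GL (Fin m) F)
    (u : ↥(upperUnitriangular (Fin m) F)) :
    ((normAbs F ((Matrix.GeneralLinearGroup.det (g * (u : GL (Fin m) F))⁻¹ : Fˣ) : F) : ℝ≥0) : ℝ) =
      ((normAbs F ((Matrix.GeneralLinearGroup.det g⁻¹ : Fˣ) : F) : ℝ≥0) : ℝ) := by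
  rw [_root_.mul_inv_rev, map_mul, show ((u : GL (Fin m) F))⁻¹ =
      ((u⁻¹ : ↥(upperUnitriangular (Fin m) F)) : GL (Fin m) F) from rfl,
    det_eq_one_of_mem_upperUnitriangular (u⁻¹).2, one_mul]

/-- The modulus weight is constant on left cosets of `U_m` (the compatibility required to descend
it to `GL_m(F) ⧸ U_m` with `Quotient.liftOn'`). -/
theorem rsDetWeight_compat (a b : GL (Fin m) F)
    (hab : @Setoid.r _ (QuotientGroup.leftRel (upperUnitriangular (Fin m) F)) a b) :
    ((normAbs F ((Matrix.GeneralLinearGroup.det a⁻¹ : Fˣ) : F) : ℝ≥0) : ℝ) =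
      ((normAbs F ((Matrix.GeneralLinearGroup.det b⁻¹ : Fˣ) : F) : ℝ≥0) : ℝ) := by
  have h := rsDetWeight_mul_upperUnitriangular a ⟨a⁻¹ * b, QuotientGroup.leftRel_apply.mp hab⟩
  rwa [mul_inv_cancel_left, eq_comm] at h

/-- The modulus weight is continuous on `GL_m(F)` (`det`, inversion and `|·|_F` are continuous). -/
theorem continuous_rsDetWeight : Continuous fun g : GL (Fin m) F =>
    ((normAbs F ((Matrix.GeneralLinearGroup.det g⁻¹ : Fˣ) : F) : ℝ≥0) : ℝ) := by
  have h1 : Continuous fun g : GL (Fin m) F => ((Matrix.GeneralLinearGroup.det g⁻¹ : Fˣ) : F) := by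
    have : (fun g : GL (Fin m) F => ((Matrix.GeneralLinearGroup.det g⁻¹ : Fˣ) : F)) =
        fun g : GL (Fin m) F => ((g⁻¹ : GL (Fin m) F) : Matrix (Fin m) (Fin m) F).det := by
      funext g; rfl
    rw [this]
    exact (Units.continuous_val.comp continuous_inv).matrix_det
  exact NNReal.continuous_coe.comp (LocalFieldHaar.continuous_normAbs.comp h1)

/-- Right-`U_m`-invariance of the JPSS integrand `B(g) · |det g⁻¹|_F ^ (s - (n-m)/2)` does not depend
on `s`: the modulus factor is invariant and non-zero, so invariance is that of `B`. -/
theorem isRightUInvariant_rsIntegrand_iff (hmn : m < n) (W : GL (Fin n) F → ℂ)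
    (W' : GL (Fin m) F → ℂ) (s t : ℂ) :
    IsRightUInvariant (rsIntegrand hmn W W' s) ↔ IsRightUInvariant (rsIntegrand hmn W W' t) := by
  have key : ∀ s : ℂ, IsRightUInvariant (rsIntegrand hmn W W' s) ↔
      ∀ (g : GL (Fin m) F) (u : ↥(upperUnitriangular (Fin m) F)),
        W (glCorner F hmn.le (g * (u : GL (Fin m) F))⁻¹) * W' (g * (u : GL (Fin m) F))⁻¹ =
          W (glCorner F hmn.le g⁻¹) * W' g⁻¹ := by
    intro s
    refine forall_congr' fun g => forall_congr' fun u => ?_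
    simp only [rsIntegrand]
    rw [rsDetWeight_mul_upperUnitriangular]
    have hne : ((((normAbs F ((Matrix.GeneralLinearGroup.det g⁻¹ : Fˣ) : F) : ℝ≥0) : ℝ) : ℂ)) ^
        (s - ((n : ℂ) - m) / 2) ≠ 0 := by
      rw [Ne, Complex.cpow_eq_zero_iff, not_and_or]
      exact Or.inl (by exact_mod_cast (rsDetWeight_pos g).ne')
    exact mul_left_injective₀ hne |>.eq_iff
  rw [key s, key t]

variable (F m) in
/-- `GL_m(F)` is locally compact for a non-archimedean local field `F` (closed in
`M_m(F) × M_m(F)ᵐᵒᵖ` under `g ↦ (g, g⁻¹)`; as `locallyCompactSpace_generalLinearGroup` of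
`GLnGelfandKazhdanInvolution`, reproved here to keep the imports light). -/
theorem locallyCompactSpace_gl_local : LocallyCompactSpace (GL (Fin m) F) := by
  haveI : T2Space F :=
    (Literature.NumberTheory.GaloisRepresentations.IsNonarchimedeanLocalField.isLocalField F).toT2Space
  haveI : LocallyCompactSpace (Matrix (Fin m) (Fin m) F) :=
    inferInstanceAs (LocallyCompactSpace (Fin m → Fin m → F))
  haveI : LocallyCompactSpace (Matrix (Fin m) (Fin m) F)ᵐᵒᵖ :=
    MulOpposite.opHomeomorph.symm.isClosedEmbedding.locallyCompactSpace
  exact Units.isClosedEmbedding_embedProduct.locallyCompactSpace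

end Weight

section Main

/-- **The local Rankin–Selberg zeta integral with a compactly supported kernel is entire** (card
`compact-kirillov-local-division`, on the tree's `rsZeta`, `m < n`, non-archimedean `F`): if the
JPSS kernel `rsKernel hmn W W' s` on `GL_m(F) ⧸ U_m` is continuous and compactly supported for every
`s` (the case of a Whittaker function `W` whose restriction to the mirabolic is compactly supported
modulo `N_n`), then `Ψ(s; W, W') = rsZeta hmn ν W W'` is an entire function of `s`. Proof: the
weight `a = |det|⁻¹_F` descends to a continuous positive function on the quotient, the kernel is
`rsKernel … c · a ^ (s - c)` with `c = (n - m)/2`, and `mellin_entire_of_hasCompactSupport` applies;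
if the integrand is not `U_m`-invariant (for one, equivalently every, `s`) the kernel is `0`. -/
theorem rsZeta_differentiable_of_hasCompactSupport
    {F : Type*} [Field F] [ValuativeRel F] [TopologicalSpace F] [IsNonarchimedeanLocalField F]
    {n m : ℕ} (hmn : m < n)
    [MeasurableSpace (GL (Fin m) F ⧸ upperUnitriangular (Fin m) F)]
    [BorelSpace (GL (Fin m) F ⧸ upperUnitriangular (Fin m) F)]
    (ν : Measure (GL (Fin m) F ⧸ upperUnitriangular (Fin m) F)) [IsFiniteMeasureOnCompacts ν]
    {W : GL (Fin n) F → ℂ} {W' : GL (Fin m) F → ℂ}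
    (hsupp : ∀ s : ℂ, HasCompactSupport (rsKernel hmn W W' s))
    (hcont : ∀ s : ℂ, Continuous (rsKernel hmn W W' s)) :
    Differentiable ℂ (rsZeta hmn ν W W') := by
  set c : ℂ := ((n : ℂ) - m) / 2 with hc
  by_cases hinv : IsRightUInvariant (rsIntegrand hmn W W' c)
  · -- the integrand is invariant for every `s`, and the kernel is `k₀ · a ^ (s - c)`
    have hinv' : ∀ s : ℂ, IsRightUInvariant (rsIntegrand hmn W W' s) := fun s =>
      (isRightUInvariant_rsIntegrand_iff hmn W W' s c).2 hinv
    -- the weight on the quotient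
    let a : GL (Fin m) F ⧸ upperUnitriangular (Fin m) F → ℝ := fun x =>
      Quotient.liftOn' x
        (fun g => ((normAbs F ((Matrix.GeneralLinearGroup.det g⁻¹ : Fˣ) : F) : ℝ≥0) : ℝ))
        rsDetWeight_compat
    have ha_mk : ∀ g : GL (Fin m) F, a (g : GL (Fin m) F ⧸ upperUnitriangular (Fin m) F) =
        ((normAbs F ((Matrix.GeneralLinearGroup.det g⁻¹ : Fˣ) : F) : ℝ≥0) : ℝ) := fun _ => rfl
    have ha : Continuous a := continuous_rsDetWeight.quotient_liftOn' _
    have hapos : ∀ x, 0 < a x := fun x => by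
      induction x using QuotientGroup.induction_on with
      | H g => rw [ha_mk]; exact rsDetWeight_pos g
    have hker : ∀ (s : ℂ) (x : GL (Fin m) F ⧸ upperUnitriangular (Fin m) F),
        rsKernel hmn W W' s x = rsKernel hmn W W' c x * ((a x : ℂ)) ^ (s - c) := by
      intro s x
      induction x using QuotientGroup.induction_on with
      | H g =>
        rw [rsKernel_mk hmn (hinv' s), rsKernel_mk hmn hinv, ha_mk]
        simp only [rsIntegrand, ← hc, sub_self, Complex.cpow_zero, mul_one]
    haveI : LocallyCompactSpace (GL (Fin m) F) := locallyCompactSpace_gl_local F m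
    have hM := mellin_entire_of_hasCompactSupport ν (hcont c) (hsupp c) ha hapos
    have hZ : rsZeta hmn ν W W' =
        (fun t : ℂ => ∫ x, rsKernel hmn W W' c x * ((a x : ℂ)) ^ t ∂ν) ∘ fun s : ℂ => s - c := by
      funext s
      simp only [rsZeta, Function.comp_apply]
      exact integral_congr_ae (Eventually.of_forall fun x => hker s x)
    rw [hZ]
    exact hM.comp (differentiable_id.sub_const c)
  · -- no invariance at any `s`: the kernel is the junk value `0`
    have h0 : ∀ s : ℂ, ¬ IsRightUInvariant (rsIntegrand hmn W W' s) := fun s h =>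
      hinv ((isRightUInvariant_rsIntegrand_iff hmn W W' s c).1 h)
    have hZ : rsZeta hmn ν W W' = fun _ => 0 := by
      funext s
      simp only [rsZeta, rsKernel, dif_neg (h0 s), integral_zero]
    rw [hZ]
    exact differentiable_const 0

end Main

end Summit.Langlands.Langlands.Theorems

end
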